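import Literature.NumberTheory.Transcendental.NesterenkoLocalUnmixed
import Literature.NumberTheory.Transcendental.NesterenkoElimination
import Literature.RingTheory.MvPolynomial.HomogeneousDimension
import Literature.RingTheory.GradedAlgebra.HomogeneousAssociatedPrimes
import Mathlib.RingTheory.Ideal.AssociatedPrime.Finiteness
import Mathlib.RingTheory.Regular.RegularSequence
import HarnessLib

/-!
# Graded decomposition above the regularity of a plane complete intersection (stub D)

Crux `stmt-Schanuel-6117`
(`Summit.Schanuel.Schanuel.Theses.DiophantineDichotomy.ApproximationProperty`), line
`orbit-interpolation-determinant`, registered stub `stub_ciDecomposition`. Everything here is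
PROVED; no definitions, no named facts.

Let `S = ℚ[x₀, x₁, x₂]` (`Rx 2`), `Q ≠ 0` a form of degree `a ≥ 1` generating a prime ideal,
`R ∉ (Q)` a form of degree `b ≥ 1`, and `𝔮` an ideal missing some linear form. Then there is a
linear form `L ∉ 𝔮` with `S_{s+N} = L^N · S_s + (Q, R)_{s+N}` for all `s ≥ a + b` and all `N`.

* `CIDecomposition.ringKrullDim_quotient_eq_one` — every associated prime `𝔯` of `(Q, R)` has
  `dim S/𝔯 = 1`: Macaulay's unmixedness theorem at the irrelevant prime `𝔪 = ker constantCoeff` for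
  the avoiding sequence `[Q, R]` (tree
  `Nesterenko.ringKrullDim_quotient_eq_of_mem_associatedPrimes_of_avoids`, `m = 2`), the associated
  primes being homogeneous (`isHomogeneous_of_mem_associatedPrimes`) hence inside `𝔪`.
* `CIDecomposition.exists_linearForm` — a linear form outside `𝔮` and outside every associated
  prime of `(Q, R)` (prime avoidance in `S_1`, `exists_linearForm_forall_notMem`), hence a
  non-zero-divisor modulo `(Q, R)` (`biUnion_associatedPrimes_eq_zero_divisors`).
* `CIDecomposition.hilbert_arith`, `CIDecomposition.idealDegree_sup_span_eq` — the Hilbert-function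
  bookkeeping: the hypersurface-section formula (`finrank_idealDegree_sup_span_add_eq`) for
  `(⊥, Q)`, `((Q), R)`, `((Q, R), L)` and `dim S_n = C(n+2, 2)` give `(Q, R, L)_{s+1} = S_{s+1}`
  for `s ≥ a + b` (Koszul exactness for the regular sequence `Q, R, L`).
* `CIDecomposition.decomp` — `S_{s+N} = L^N S_s + (Q, R)_{s+N}` by induction on `N`
  (`idealDegree_sup_span_singleton`), and `stub_ciDecomposition`.

Sources: Nesterenko–Philippon (eds.), LNM 1752, Ch. 10 §3 (Macaulay) and Ch. 11 §2.2 (Hilbert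
functions of hypersurface sections); Philippon, Bull. SMF 114 (1986), Lemme 3.1.
-/

set_option linter.dupNamespace false

noncomputable section

namespace Summit.Schanuel.Schanuel.Cruxes.ApproximationProperty.OrbitInterpolationDeterminant

open Literature.NumberTheory.Transcendental.Nesterenko MvPolynomial Module
open Literature.RingTheory.MvPolynomial

namespace CIDecomposition

/-! ## Macaulay: the associated primes of `(Q, R)` have Krull coheight `1` -/

/-- A form of positive degree lies in the irrelevant ideal `ker constantCoeff`. [folklore] -/
theorem mem_ker_constantCoeff_of_isHomogeneous {P : Rx 2} {n : ℕ} (hP : P.IsHomogeneous n)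
    (hn : 1 ≤ n) : P ∈ RingHom.ker (constantCoeff : Rx 2 →+* ℚ) := by
  rw [RingHom.mem_ker, constantCoeff_eq]
  exact hP.coeff_eq_zero (by rw [map_zero]; omega)

/-- `span {P}` is a homogeneous ideal for a form `P` (for any graded structure with the pieces
`S_n`; used with Mathlib's `MvPolynomial.gradedAlgebra`, installed by `letI` in the proofs below).
[folklore] -/
theorem isHomogeneous_span [GradedAlgebra (homogeneousSubmodule (Fin (2 + 1)) ℚ)] {P : Rx 2} {n : ℕ}
    (hP : P.IsHomogeneous n) :
    (Ideal.span {P}).IsHomogeneous (homogeneousSubmodule (Fin (2 + 1)) ℚ) :=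
  Ideal.homogeneous_span _ _ fun x hx => ⟨n, by rw [Set.mem_singleton_iff.mp hx]; exact hP⟩

/-- **Macaulay's unmixedness for a plane complete intersection.** For `Q ≠ 0` a form of degree
`a ≥ 1` with `(Q)` prime and `R ∉ (Q)` a form of degree `b ≥ 1`, every associated prime `𝔯` of
`S/(Q, R)`, `S = ℚ[x₀, x₁, x₂]`, has `dim S/𝔯 = 1` (no embedded component at the irrelevant
ideal). [cite: NesterenkoPhilippon2001, Ch. 10 §3, proof of Prop. 3.6] -/
theorem ringKrullDim_quotient_eq_one {Q R : Rx 2} {a b : ℕ} (hQ0 : Q ≠ 0)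
    (hQ : Q.IsHomogeneous a) (hR : R.IsHomogeneous b) (ha : 1 ≤ a) (hb : 1 ≤ b)
    (hprime : (Ideal.span {Q}).IsPrime) (hRQ : R ∉ Ideal.span {Q}) {𝔯 : Ideal (Rx 2)}
    (h𝔯 : 𝔯 ∈ associatedPrimes (Rx 2) (Rx 2 ⧸ (Ideal.span {Q} ⊔ Ideal.span {R}))) :
    ringKrullDim (Rx 2 ⧸ 𝔯) = (1 : ℕ) := by
  have hE : Ideal.ofList [Q, R] = Ideal.span {Q} ⊔ Ideal.span {R} := by
    rw [Ideal.ofList_cons, Ideal.ofList_singleton]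
  rw [← hE] at h𝔯
  have h𝔯' := (mem_associatedPrimes_quotient_iff _ _).mp h𝔯
  set 𝔪 : Ideal (Rx 2) := RingHom.ker (constantCoeff : Rx 2 →+* ℚ)
  haveI : 𝔪.IsPrime := isMaximal_ker_constantCoeff.isPrime
  have hE𝔪 : ∀ e ∈ [Q, R], e ∈ 𝔪 := by
    intro e he
    simp only [List.mem_cons, List.not_mem_nil, or_false] at he
    rcases he with rfl | rfl
    · exact mem_ker_constantCoeff_of_isHomogeneous hQ ha
    · exact mem_ker_constantCoeff_of_isHomogeneous hR hb
  have havoid : ∀ (L₁ : List (Rx 2)) (e : Rx 2) (L₂ : List (Rx 2)), [Q, R] = L₁ ++ e :: L₂ →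
      ∀ 𝔮 ∈ (Ideal.ofList L₁).minimalPrimes, 𝔮 ≤ 𝔪 → e ∉ 𝔮 := by
    intro L₁ e L₂ hsplit 𝔮 h𝔮 _
    rcases L₁ with _ | ⟨x, _ | ⟨y, L₁'⟩⟩
    · -- `e = Q`, minimal primes of `(0)` are `{(0)}`
      rw [List.nil_append] at hsplit
      obtain ⟨hQe, -⟩ := List.cons_eq_cons.mp hsplit
      rw [Ideal.ofList_nil, Ideal.minimalPrimes_eq_subsingleton_self, Set.mem_singleton_iff] at h𝔮
      rw [← hQe, h𝔮, Ideal.mem_bot]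
      exact hQ0
    · -- `e = R`, minimal primes of the prime `(Q)` are `{(Q)}`
      rw [List.singleton_append] at hsplit
      obtain ⟨hQx, hrest⟩ := List.cons_eq_cons.mp hsplit
      obtain ⟨hRe, -⟩ := List.cons_eq_cons.mp hrest
      rw [← hQx, Ideal.ofList_singleton] at h𝔮
      haveI := hprime
      rw [Ideal.minimalPrimes_eq_subsingleton_self, Set.mem_singleton_iff] at h𝔮
      rw [← hRe, h𝔮]
      exact hRQ
    · have := congrArg List.length hsplit
      simp only [List.length_cons, List.length_append, List.length_nil] at this
      omega
  letI : GradedAlgebra (homogeneousSubmodule (Fin (2 + 1)) ℚ) := MvPolynomial.gradedAlgebra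
  have hJhom : (Ideal.ofList [Q, R]).IsHomogeneous (homogeneousSubmodule (Fin (2 + 1)) ℚ) := by
    rw [hE]; exact (isHomogeneous_span hQ).sup (isHomogeneous_span hR)
  have h𝔯hom := Literature.RingTheory.GradedAlgebra.isHomogeneous_of_mem_associatedPrimes
    (homogeneousSubmodule (Fin (2 + 1)) ℚ) hJhom h𝔯'
  have h𝔯𝔪 : 𝔯 ≤ 𝔪 :=
    le_ker_constantCoeff_of_isHomogeneous h𝔯hom (IsAssociatedPrime.isPrime h𝔯).ne_top
  have h := (ringKrullDim_quotient_eq_of_mem_associatedPrimes_of_avoids (m := 2) 𝔪 hE𝔪 havoid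
    h𝔯' h𝔯𝔪).2.2
  rw [h]
  rfl

/-! ## A linear non-zero-divisor modulo `(Q, R)` outside `𝔮` -/

/-- **Prime avoidance by a linear form**: under the hypotheses of `ringKrullDim_quotient_eq_one`
and for an ideal `𝔮` missing some linear form, there is a linear form `L ∉ 𝔮`, `L ≠ 0`, which is
a non-zero-divisor modulo `(Q, R)` (it avoids the finitely many associated primes of `S/(Q, R)`,
none of which contains all linear forms since each has `dim = 1 ≠ 0`).
[cite: NesterenkoPhilippon2001, Ch. 11, proof of Prop. 2.2] -/
theorem exists_linearForm {Q R : Rx 2} {a b : ℕ} (hQ0 : Q ≠ 0)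
    (hQ : Q.IsHomogeneous a) (hR : R.IsHomogeneous b) (ha : 1 ≤ a) (hb : 1 ≤ b)
    (hprime : (Ideal.span {Q}).IsPrime) (hRQ : R ∉ Ideal.span {Q}) (𝔮 : Ideal (Rx 2))
    (h𝔮 : ∃ L : Rx 2, L.IsHomogeneous 1 ∧ L ∉ 𝔮) :
    ∃ L : Rx 2, L.IsHomogeneous 1 ∧ L ∉ 𝔮 ∧ L ≠ 0 ∧
      ∀ f, L * f ∈ Ideal.span {Q} ⊔ Ideal.span {R} → f ∈ Ideal.span {Q} ⊔ Ideal.span {R} := by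
  classical
  set J₀ : Ideal (Rx 2) := Ideal.span {Q} ⊔ Ideal.span {R}
  have hfin := associatedPrimes.finite (Rx 2) (Rx 2 ⧸ J₀)
  have hP : ∀ 𝔭 ∈ insert 𝔮 hfin.toFinset, ∃ i, (X i : Rx 2) ∉ 𝔭 := by
    intro 𝔭 h𝔭
    rcases Finset.mem_insert.mp h𝔭 with rfl | h𝔭
    · obtain ⟨L₀, hL₀1, hL₀𝔮⟩ := h𝔮
      by_contra hcon
      push Not at hcon
      exact hL₀𝔮 (ker_constantCoeff_le_of_forall_X_mem hcon
        (mem_ker_constantCoeff_of_isHomogeneous hL₀1 le_rfl))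
    · have h𝔯 := hfin.mem_toFinset.mp h𝔭
      haveI : 𝔭.IsPrime := IsAssociatedPrime.isPrime h𝔯
      refine exists_X_notMem_of_ringKrullDim_ne_zero ?_
      rw [ringKrullDim_quotient_eq_one hQ0 hQ hR ha hb hprime hRQ h𝔯]
      norm_num
  obtain ⟨L, hL1, hL0, hL⟩ := exists_linearForm_forall_notMem (K := ℚ) (m := 2 + 1)
    (Nat.succ_pos 2) (insert 𝔮 hfin.toFinset) hP
  refine ⟨L, hL1, hL 𝔮 (Finset.mem_insert_self _ _), hL0, fun f hf => ?_⟩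
  by_contra hfJ
  have hmk : Ideal.Quotient.mk J₀ f ≠ 0 := mt Ideal.Quotient.eq_zero_iff_mem.mp hfJ
  have hzero : L • Ideal.Quotient.mk J₀ f = 0 := by
    rw [Algebra.smul_def, Ideal.Quotient.algebraMap_eq, ← map_mul,
      Ideal.Quotient.eq_zero_iff_mem]
    exact hf
  have hmem : L ∈ {r : Rx 2 | ∃ x : Rx 2 ⧸ J₀, x ≠ 0 ∧ r • x = 0} := ⟨_, hmk, hzero⟩
  rw [← biUnion_associatedPrimes_eq_zero_divisors] at hmem
  obtain ⟨𝔯, h𝔯, hL𝔯⟩ := Set.mem_iUnion₂.mp hmem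
  exact hL 𝔯 (Finset.mem_insert_of_mem (hfin.mem_toFinset.mpr h𝔯)) hL𝔯

/-! ## Hilbert-function bookkeeping -/

/-- The arithmetic of the three hypersurface sections: with `d (n+1) = d n + (n + 2)` (Pascal),
`q (t + a) = d t` (the section `(0) + (Q)`), `j (t + b) + q t = q (t + b) + d t` (the section
`(Q) + (R)`) and `jl (s+1) + j s = j (s+1) + d s` (the section `(Q, R) + (L)`), one gets
`jl (s + 1) = d (s + 1)` for `s ≥ a + b`. [folklore] -/
theorem hilbert_arith {d q j jl : ℕ → ℕ} {a b s : ℕ} (hs : a + b ≤ s)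
    (hd : ∀ n, d (n + 1) = d n + (n + 2))
    (hq : ∀ t n, n = t + a → q n = d t)
    (hj : ∀ t n, n = t + b → j n + q t = q n + d t)
    (hjl : jl (s + 1) + j s = j (s + 1) + d s) :
    jl (s + 1) = d (s + 1) := by
  obtain ⟨v, rfl⟩ : ∃ v, s = v + a + b := ⟨s - a - b, by omega⟩
  have h1 := hq v (v + a) rfl
  have h2 := hq (v + b) (v + a + b) (by omega)
  have h3 := hq (v + 1) (v + a + 1) (by omega)
  have h4 := hq (v + b + 1) (v + a + b + 1) (by omega)
  have h5 := hj (v + a) (v + a + b) rfl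
  have h6 := hj (v + a + 1) (v + a + b + 1) (by omega)
  have h7 := hd (v + a + b)
  have h8 := hd (v + b)
  have h9 := hd (v + a)
  have h10 := hd v
  omega

/-- Pascal's rule for `dim S_n = C(n + 2, 2)`: `dim S_{n+1} = dim S_n + (n + 2)`. [folklore] -/
theorem finrank_homogeneousSubmodule_succ (n : ℕ) :
    finrank ℚ (homogeneousSubmodule (Fin (2 + 1)) ℚ (n + 1)) =
      finrank ℚ (homogeneousSubmodule (Fin (2 + 1)) ℚ n) + (n + 2) := by
  rw [Literature.RingTheory.HilbertSamuel.finrank_homogeneousSubmodule_fin,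
    Literature.RingTheory.HilbertSamuel.finrank_homogeneousSubmodule_fin,
    show n + 1 + (2 + 1) - 1 = n + 2 + 1 by omega, show n + (2 + 1) - 1 = n + 2 by omega]
  have h1 : (n + 2 + 1).choose (n + 1) = (n + 2).choose n + (n + 2).choose (n + 1) :=
    Nat.choose_succ_succ (n + 2) n
  have h2 : (n + 2).choose (n + 1) = n + 2 := Nat.choose_succ_self_right (n + 1)
  omega

/-- **`(Q, R, L)_{s+1} = S_{s+1}` for `s ≥ a + b`** when `L` is a linear non-zero-divisor modulo
`(Q, R)` (three applications of the hypersurface-section formula).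
[cite: Philippon1986, Lemme 3.1] -/
theorem idealDegree_sup_span_eq {Q R L : Rx 2} {a b : ℕ} (hQ0 : Q ≠ 0)
    (hQ : Q.IsHomogeneous a) (hR : R.IsHomogeneous b)
    (hprime : (Ideal.span {Q}).IsPrime) (hRQ : R ∉ Ideal.span {Q}) (hL1 : L.IsHomogeneous 1)
    (hL0 : L ≠ 0)
    (hnzd : ∀ f, L * f ∈ Ideal.span {Q} ⊔ Ideal.span {R} → f ∈ Ideal.span {Q} ⊔ Ideal.span {R})
    {s : ℕ} (hs : a + b ≤ s) :
    idealDegree (Ideal.span {Q} ⊔ Ideal.span {R} ⊔ Ideal.span {L}) (s + 1) =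
      homogeneousSubmodule (Fin (2 + 1)) ℚ (s + 1) := by
  letI : GradedAlgebra (homogeneousSubmodule (Fin (2 + 1)) ℚ) := MvPolynomial.gradedAlgebra
  have hQhom := isHomogeneous_span hQ
  have hJhom :
      (Ideal.span {Q} ⊔ Ideal.span {R}).IsHomogeneous (homogeneousSubmodule (Fin (2 + 1)) ℚ) :=
    hQhom.sup (isHomogeneous_span hR)
  have hR0 : R ≠ 0 := by
    rintro rfl
    exact hRQ (Ideal.zero_mem _)
  have hnzdQ : ∀ f, Q * f ∈ (⊥ : Ideal (Rx 2)) → f ∈ (⊥ : Ideal (Rx 2)) := fun f hf => by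
    rw [Ideal.mem_bot] at hf ⊢
    exact (mul_eq_zero.mp hf).resolve_left hQ0
  have hnzdR : ∀ f, R * f ∈ Ideal.span {Q} → f ∈ Ideal.span {Q} := fun f hf =>
    (hprime.mem_or_mem hf).resolve_left hRQ
  have hq : ∀ t n, n = t + a → finrank ℚ (idealDegree (Ideal.span {Q}) n) =
      finrank ℚ (homogeneousSubmodule (Fin (2 + 1)) ℚ t) := by
    rintro t n rfl
    have h := finrank_idealDegree_sup_span_add_eq (Ideal.IsHomogeneous.bot _) hQ0 hQ hnzdQ t
    rw [bot_sup_eq, idealDegree_bot, idealDegree_bot, finrank_bot] at h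
    simpa using h
  have hj : ∀ t n, n = t + b →
      finrank ℚ (idealDegree (Ideal.span {Q} ⊔ Ideal.span {R}) n) +
        finrank ℚ (idealDegree (Ideal.span {Q}) t) =
      finrank ℚ (idealDegree (Ideal.span {Q}) n) +
        finrank ℚ (homogeneousSubmodule (Fin (2 + 1)) ℚ t) := by
    rintro t n rfl
    exact finrank_idealDegree_sup_span_add_eq hQhom hR0 hR hnzdR t
  have hjl := finrank_idealDegree_sup_span_add_eq hJhom hL0 hL1 hnzd s
  have hfin := hilbert_arith (jl := fun n =>
    finrank ℚ (idealDegree (Ideal.span {Q} ⊔ Ideal.span {R} ⊔ Ideal.span {L}) n)) hs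
    finrank_homogeneousSubmodule_succ hq hj hjl
  haveI := finite_homogeneousSubmodule (K := ℚ) (σ := Fin (2 + 1)) (s + 1)
  exact Submodule.eq_of_le_of_finrank_eq (idealDegree_le_homogeneousSubmodule _ _) hfin

/-! ## The decomposition `S_{s+N} = L^N S_s + (Q, R)_{s+N}` -/

/-- One step: if `(Q, R, L)_{n+1} = S_{n+1}` for forms `Q`, `R` and a linear form `L`, every form
`F` of degree `n + 1` is `L G` modulo `(Q, R)` for a form `G` of degree `n`. [folklore] -/
theorem decomp_step {Q R L : Rx 2} {a b : ℕ} (hQ : Q.IsHomogeneous a) (hR : R.IsHomogeneous b)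
    (hL1 : L.IsHomogeneous 1) {n : ℕ}
    (hfull : idealDegree (Ideal.span {Q} ⊔ Ideal.span {R} ⊔ Ideal.span {L}) (n + 1) =
      homogeneousSubmodule (Fin (2 + 1)) ℚ (n + 1))
    {F : Rx 2} (hF : F.IsHomogeneous (n + 1)) :
    ∃ G : Rx 2, G.IsHomogeneous n ∧ F - L * G ∈ Ideal.span {Q} ⊔ Ideal.span {R} := by
  letI : GradedAlgebra (homogeneousSubmodule (Fin (2 + 1)) ℚ) := MvPolynomial.gradedAlgebra
  have hJ :
      (Ideal.span {Q} ⊔ Ideal.span {R}).IsHomogeneous (homogeneousSubmodule (Fin (2 + 1)) ℚ) :=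
    (isHomogeneous_span hQ).sup (isHomogeneous_span hR)
  have hF' : F ∈ idealDegree (Ideal.span {Q} ⊔ Ideal.span {R} ⊔ Ideal.span {L}) (n + 1) := by
    rw [hfull]
    exact hF
  rw [idealDegree_sup_span_singleton hJ hL1 n] at hF'
  obtain ⟨j, hj, g, hg, hsum⟩ := Submodule.mem_sup.mp hF'
  obtain ⟨G, hG, rfl⟩ := Submodule.mem_map.mp hg
  refine ⟨G, hG, ?_⟩
  have : F - L * G = j := by
    rw [← hsum, LinearMap.mulLeft_apply, add_sub_cancel_right]
  rw [this]
  exact (mem_idealDegree.mp hj).1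

/-- Induction on `N`: if `(Q, R, L)_{n+1} = S_{n+1}` for all `n ≥ s`, then every form of degree
`s + N` is `L^N G` modulo `(Q, R)` for a form `G` of degree `s`. [folklore] -/
theorem decomp {Q R L : Rx 2} {a b : ℕ} (hQ : Q.IsHomogeneous a) (hR : R.IsHomogeneous b)
    (hL1 : L.IsHomogeneous 1) {s : ℕ}
    (hfull : ∀ n, s ≤ n → idealDegree (Ideal.span {Q} ⊔ Ideal.span {R} ⊔ Ideal.span {L}) (n + 1) =
      homogeneousSubmodule (Fin (2 + 1)) ℚ (n + 1)) :
    ∀ (N : ℕ) (F : Rx 2), F.IsHomogeneous (s + N) →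
      ∃ G : Rx 2, G.IsHomogeneous s ∧ F - L ^ N * G ∈ Ideal.span {Q} ⊔ Ideal.span {R} := by
  intro N
  induction N with
  | zero =>
    intro F hF
    exact ⟨F, by simpa using hF, by simp⟩
  | succ N ih =>
    intro F hF
    obtain ⟨G₁, hG₁, h₁⟩ := decomp_step hQ hR hL1 (hfull (s + N) (Nat.le_add_right s N)) hF
    obtain ⟨G, hG, h⟩ := ih G₁ hG₁
    refine ⟨G, hG, ?_⟩
    have : F - L ^ (N + 1) * G = (F - L * G₁) + L * (G₁ - L ^ N * G) := by ring
    rw [this]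
    exact Ideal.add_mem _ h₁ (Ideal.mul_mem_left _ L h)

end CIDecomposition

/-- **Stub D — graded decomposition above the regularity of a plane complete intersection.** Let
`Q ≠ 0` be a form of degree `a ≥ 1` of `S = ℚ[x₀, x₁, x₂]` generating a prime ideal, `R ∉ (Q)` a
form of degree `b ≥ 1`, and `𝔮` an ideal missing some linear form. Then there is a linear form
`L ∉ 𝔮` such that for all `s ≥ a + b` and all `N`: `S_{s+N} = L^N · S_s + (Q, R)_{s+N}` (Macaulay's
unmixedness for `(Q, R)`, prime avoidance in `S_1`, and the Hilbert functions of the hypersurface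
sections by the regular sequence `Q, R, L`).
[cite: NesterenkoPhilippon2001, Ch. 10 §3 (proof of Prop. 3.6) and Ch. 11 §2.2] -/
theorem stub_ciDecomposition :
    ∀ (Q R : Rx 2) (a b : ℕ), Q ≠ 0 → Q.IsHomogeneous a → R.IsHomogeneous b → 1 ≤ a → 1 ≤ b →
      (Ideal.span {Q}).IsPrime → R ∉ Ideal.span {Q} →
      ∀ 𝔮 : Ideal (Rx 2), (∃ L : Rx 2, L.IsHomogeneous 1 ∧ L ∉ 𝔮) →
      ∃ L : Rx 2, L.IsHomogeneous 1 ∧ L ∉ 𝔮 ∧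
        ∀ (s N : ℕ) (F : Rx 2), a + b ≤ s → F.IsHomogeneous (s + N) →
          ∃ G : Rx 2, G.IsHomogeneous s ∧ F - L ^ N * G ∈ Ideal.span {Q} ⊔ Ideal.span {R} := by
  intro Q R a b hQ0 hQ hR ha hb hprime hRQ 𝔮 h𝔮
  obtain ⟨L, hL1, hL𝔮, hL0, hnzd⟩ :=
    CIDecomposition.exists_linearForm hQ0 hQ hR ha hb hprime hRQ 𝔮 h𝔮
  refine ⟨L, hL1, hL𝔮, fun s N F hs hF => ?_⟩
  exact CIDecomposition.decomp hQ hR hL1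
    (fun n hn => CIDecomposition.idealDegree_sup_span_eq hQ0 hQ hR hprime hRQ hL1 hL0 hnzd
      (hs.trans hn)) N F hF

end Summit.Schanuel.Schanuel.Cruxes.ApproximationProperty.OrbitInterpolationDeterminant

end
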